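import Mathlib.RingTheory.Polynomial.UniqueFactorization
import Mathlib.Algebra.MvPolynomial.Equiv
import Mathlib.Algebra.Polynomial.Degree.Domain
import Mathlib.RingTheory.Ideal.Maximal
import Mathlib.Tactic.LinearCombination
import HarnessLib

/-!
# The `E₈⁰` forms: primality and strict transforms of `z² + x³ + y⁵`

Support file for crux stmt-ResolutionOfSingularities-15315
(`FrobeniusLadder.FInjectiveMacaulayfication`, line `Sketch`, lead seat c4, cycle 5, wave 2): stub
`stub_e8Forms` of the §7 CALIBRATION package (`Bl_𝔪 E₈⁰` in characteristic `5`, through the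
blow-up glue E6′). Coordinates downstairs: `X 0 = x`, `X 1 = y`, `X 2 = z`, and
`f = X 2 ^ 2 + X 0 ^ 3 + X 1 ^ 5` is Artin's normal form `E₈⁰` of the rational double point
([Artin1977]; only the polynomial is used here). On the chart of the generator `Xᵢ` of the point
blow-up, the substitution `θᵢ : Xᵢ ↦ Xᵢ, Xⱼ ↦ Xⱼ Xᵢ (j ≠ i)` turns `f` into `Xᵢ² · g` with the
strict transforms

* `x`-chart: `θ₀ f = X₀² gₓ`, `gₓ = X 2 ^ 2 + X 0 + X 0 ^ 3 * X 1 ^ 5`;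
* `y`-chart: `θ₁ f = X₁² g_y`, `g_y = X 2 ^ 2 + X 1 * X 0 ^ 3 + X 1 ^ 3`.

What is proved (over EVERY field `k`, no characteristic hypothesis):

* `irreducible_X_sq_add_C` — over a domain `D`, `T² + c` is irreducible as soon as `-c` is not a
  square (`Polynomial.Monic.not_irreducible_iff_exists_add_mul_eq_coeff`: a reducible monic
  quadratic is `(T + c₁)(T + c₂)`, and `c₁ + c₂ = 0` forces `c = -c₁²`).
* `prime_and_not_dvd_of_ringEquiv` — transport: if a ring `A` is identified with `D[T]` (`D` a UFD)
  so that `g ↦ T² + c` with `-c` a non-square, then `g` is prime in `A` and divides no element that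
  corresponds to a non-zero constant `C d` (degree count).
* `mul_self_ne_neg_of_aeval` — the non-square test used: if some evaluation of `c ∈ k[X₀,X₁]` into
  `k[T]` is `-T^(2n+1)`, then `-c` is not a square (odd degree).
* `stub_e8Forms` — the registered statement: `(f)`, `(gₓ)`, `(g_y)` are prime ideals of
  `k[X₀,X₁,X₂]`, `f ≠ 0`, `X₀ ∉ (f)`, `X₀ ∉ (gₓ)`, `X₁ ∉ (g_y)`, and the two identities
  `θ₀ f = X₀² gₓ`, `θ₁ f = X₁² g_y`. All three forms are `X₂² + c(X₀,X₁)`; the identification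
  `k[X₀,X₁,X₂] ≃ k[X₀,X₁][T]`, `X₂ ↦ T` is `renameEquiv (swap 0 2)` followed by `finSuccEquiv`, and
  `-c` is seen to be a non-square by setting one variable to `0` (`-X³`, `-X`, `-X³`).

References: M. Artin, *Coverings of the rational double points in characteristic `p`* [Artin1977]
(the form `E₈⁰`); the algebra is folklore.
-/

-- single-problem summit: the doubled namespace component is forced
set_option linter.dupNamespace false

namespace Summit.ResolutionOfSingularities.ResolutionOfSingularities.Theorems.FInjectiveMacaulayfication.E8Forms

open Polynomial

/-- **A monic quadratic `T² + c` over a domain is irreducible when `-c` is not a square**: a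
nontrivial factorisation of a monic quadratic can be taken as `(T + c₁)(T + c₂)`
(`Polynomial.Monic.not_irreducible_iff_exists_add_mul_eq_coeff`); comparing coefficients,
`c₁ + c₂ = 0` and `c₁ c₂ = c`, so `c₁ · c₁ = -c`. [folklore] -/
theorem irreducible_X_sq_add_C {D : Type*} [CommRing D] [IsDomain D] (c : D)
    (hc : ∀ a : D, a * a ≠ -c) : Irreducible (X ^ 2 + C c : D[X]) := by
  have hm : (X ^ 2 + C c : D[X]).Monic := monic_X_pow_add_C c two_ne_zero
  have hnd : (X ^ 2 + C c : D[X]).natDegree = 2 := natDegree_X_pow_add_C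
  by_contra h
  rw [hm.not_irreducible_iff_exists_add_mul_eq_coeff hnd] at h
  obtain ⟨c₁, c₂, h0, h1⟩ := h
  simp only [coeff_add, coeff_X_pow, coeff_C, if_true, if_neg (Nat.succ_ne_zero 1).symm,
    if_neg (show (1 : ℕ) ≠ 2 by decide), if_neg (Nat.succ_ne_zero 0), zero_add] at h0 h1
  exact hc c₁ (by linear_combination h0 - c₁ * h1)

/-- **Transport of primality along `A ≃ D[T]`.** Let `D` be a unique factorisation domain and
`e : A ≃+* D[T]` a ring isomorphism with `e g = T² + c`, where `-c` is not a square in `D`. Then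
`g` is prime in `A` (irreducible in the UFD `D[T]`, hence prime, and primality is invariant under
isomorphism), and `g` divides no `t` with `e t = C d`, `d ≠ 0` (a divisor of a non-zero constant has
degree `0`, but `T² + c` has degree `2`). [folklore] -/
theorem prime_and_not_dvd_of_ringEquiv {A D : Type*} [CommRing A] [CommRing D] [IsDomain D]
    [UniqueFactorizationMonoid D] (e : A ≃+* D[X]) (g : A) (c : D) (hg : e g = X ^ 2 + C c)
    (hc : ∀ a : D, a * a ≠ -c) :
    Prime g ∧ ∀ (t : A) (d : D), d ≠ 0 → e t = C d → ¬ g ∣ t := by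
  have hirr : Irreducible (e g) := hg ▸ irreducible_X_sq_add_C c hc
  refine ⟨(MulEquiv.prime_iff e).mp hirr.prime, fun t d hd ht hdvd => ?_⟩
  obtain ⟨q, rfl⟩ := hdvd
  have h1 : (X ^ 2 + C c : D[X]) ∣ C d := ⟨e q, by rw [← hg, ← map_mul, ht]⟩
  have h2 := natDegree_le_of_dvd h1 (C_ne_zero.mpr hd)
  rw [natDegree_X_pow_add_C, natDegree_C] at h2
  omega

/-- **Odd-degree test for non-squares.** If an evaluation `k[X₀,X₁] → k[T]` sends `c` to
`-T^(2n+1)`, then `-c` is not a square in `k[X₀,X₁]`: a square root `a` would evaluate to a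
polynomial `b` with `b² = T^(2n+1)`, of degree `2 deg b = 2n + 1`. [folklore] -/
theorem mul_self_ne_neg_of_aeval {k : Type} [Field k] {c : MvPolynomial (Fin 2) k}
    (v : Fin 2 → k[X]) (n : ℕ) (hv : MvPolynomial.aeval v c = -(X ^ (2 * n + 1) : k[X]))
    (a : MvPolynomial (Fin 2) k) : a * a ≠ -c := by
  intro h
  have h2 : MvPolynomial.aeval v a * MvPolynomial.aeval v a = (X ^ (2 * n + 1) : k[X]) := by
    rw [← map_mul, h, map_neg, hv, neg_neg]
  have hX : (X ^ (2 * n + 1) : k[X]) ≠ 0 := pow_ne_zero _ X_ne_zero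
  have ha : MvPolynomial.aeval v a ≠ 0 := by
    intro h0
    rw [h0, zero_mul] at h2
    exact hX h2.symm
  have h3 := congrArg Polynomial.natDegree h2
  rw [natDegree_mul ha ha, natDegree_X_pow] at h3
  omega

/-- **The `E₈⁰` forms** (registered stub `stub_e8Forms` of the §7 calibration): for
`f = X₂² + X₀³ + X₁⁵`, `gₓ = X₂² + X₀ + X₀³X₁⁵`, `g_y = X₂² + X₁X₀³ + X₁³` in `k[X₀,X₁,X₂]` over any
field `k`: `(f)`, `(gₓ)`, `(g_y)` are prime, `f ≠ 0`, `X₀ ∉ (f)`, `X₀ ∉ (gₓ)`, `X₁ ∉ (g_y)`, and the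
strict-transform identities `θ₀ f = X₀² gₓ`, `θ₁ f = X₁² g_y` for the chart substitutions
`θᵢ : Xᵢ ↦ Xᵢ, Xⱼ ↦ XⱼXᵢ`. Proof: identify `k[X₀,X₁,X₂]` with `k[X₀,X₁][T]`, `X₂ ↦ T`
(`renameEquiv (swap 0 2)` then `finSuccEquiv`); each form becomes `T² + c` with `-c` a non-square by
the odd-degree test after setting one variable to `0` (`-T³`, `-T`, `-T³`), so
`prime_and_not_dvd_of_ringEquiv` applies; the identities are `ring`. [folklore] -/
theorem stub_e8Forms : ∀ (k : Type) [Field k] (f gx gy : MvPolynomial (Fin 3) k),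
    f = MvPolynomial.X 2 ^ 2 + MvPolynomial.X 0 ^ 3 + MvPolynomial.X 1 ^ 5 →
    gx = MvPolynomial.X 2 ^ 2 + MvPolynomial.X 0 + MvPolynomial.X 0 ^ 3 * MvPolynomial.X 1 ^ 5 →
    gy = MvPolynomial.X 2 ^ 2 + MvPolynomial.X 1 * MvPolynomial.X 0 ^ 3 + MvPolynomial.X 1 ^ 3 →
    ((Ideal.span {f}).IsPrime ∧ f ≠ 0 ∧ MvPolynomial.X 0 ∉ Ideal.span {f}) ∧
    ((Ideal.span {gx}).IsPrime ∧ MvPolynomial.X 0 ∉ Ideal.span {gx} ∧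
      MvPolynomial.aeval (fun j : Fin 3 => if j = 0 then (MvPolynomial.X 0 : MvPolynomial (Fin 3) k)
        else MvPolynomial.X j * MvPolynomial.X 0) f = MvPolynomial.X 0 ^ 2 * gx) ∧
    ((Ideal.span {gy}).IsPrime ∧ MvPolynomial.X 1 ∉ Ideal.span {gy} ∧
      MvPolynomial.aeval (fun j : Fin 3 => if j = 1 then (MvPolynomial.X 1 : MvPolynomial (Fin 3) k)
        else MvPolynomial.X j * MvPolynomial.X 1) f = MvPolynomial.X 1 ^ 2 * gy) := by
  intro k _ f gx gy hf hgx hgy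
  -- the identification `k[X₀,X₁,X₂] ≃ k[X₀,X₁][T]`: `X 2 ↦ T`, `X 0 ↦ C (X 1)`, `X 1 ↦ C (X 0)`
  obtain ⟨e, he0, he1, he2⟩ : ∃ e : MvPolynomial (Fin 3) k ≃+* (MvPolynomial (Fin 2) k)[X],
      e (MvPolynomial.X 0) = C (MvPolynomial.X 1) ∧ e (MvPolynomial.X 1) = C (MvPolynomial.X 0) ∧
        e (MvPolynomial.X 2) = Polynomial.X := by
    refine ⟨((MvPolynomial.renameEquiv k (Equiv.swap (0 : Fin 3) 2)).trans
      (MvPolynomial.finSuccEquiv k 2)).toRingEquiv, ?_, ?_, ?_⟩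
    · show MvPolynomial.finSuccEquiv k 2
          (MvPolynomial.rename (Equiv.swap (0 : Fin 3) 2) (MvPolynomial.X 0)) = _
      rw [MvPolynomial.rename_X, Equiv.swap_apply_left]
      exact MvPolynomial.finSuccEquiv_X_succ (j := 1)
    · show MvPolynomial.finSuccEquiv k 2
          (MvPolynomial.rename (Equiv.swap (0 : Fin 3) 2) (MvPolynomial.X 1)) = _
      rw [MvPolynomial.rename_X, Equiv.swap_apply_of_ne_of_ne (by decide) (by decide)]
      exact MvPolynomial.finSuccEquiv_X_succ (j := 0)
    · show MvPolynomial.finSuccEquiv k 2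
          (MvPolynomial.rename (Equiv.swap (0 : Fin 3) 2) (MvPolynomial.X 2)) = _
      rw [MvPolynomial.rename_X, Equiv.swap_apply_right]
      exact MvPolynomial.finSuccEquiv_X_zero
  -- images of the three forms
  have hef : e f = X ^ 2 + C (MvPolynomial.X 1 ^ 3 + MvPolynomial.X 0 ^ 5) := by
    subst hf
    simp only [map_add, map_pow, he0, he1, he2]
    ring
  have hegx :
      e gx = X ^ 2 + C (MvPolynomial.X 1 + MvPolynomial.X 1 ^ 3 * MvPolynomial.X 0 ^ 5) := by
    subst hgx
    simp only [map_add, map_mul, map_pow, he0, he1, he2]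
    ring
  have hegy :
      e gy = X ^ 2 + C (MvPolynomial.X 0 * MvPolynomial.X 1 ^ 3 + MvPolynomial.X 0 ^ 3) := by
    subst hgy
    simp only [map_add, map_mul, map_pow, he0, he1, he2]
    ring
  -- the non-square tests
  have hcf : ∀ a : MvPolynomial (Fin 2) k,
      a * a ≠ -(MvPolynomial.X 1 ^ 3 + MvPolynomial.X 0 ^ 5) :=
    mul_self_ne_neg_of_aeval ![0, -Polynomial.X] 1 (by
      simp only [map_add, map_pow, MvPolynomial.aeval_X, Matrix.cons_val_zero,
        Matrix.cons_val_one]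
      ring)
  have hcgx : ∀ a : MvPolynomial (Fin 2) k,
      a * a ≠ -(MvPolynomial.X 1 + MvPolynomial.X 1 ^ 3 * MvPolynomial.X 0 ^ 5) :=
    mul_self_ne_neg_of_aeval ![0, -Polynomial.X] 0 (by
      simp only [map_add, map_mul, map_pow, MvPolynomial.aeval_X, Matrix.cons_val_zero,
        Matrix.cons_val_one]
      ring)
  have hcgy : ∀ a : MvPolynomial (Fin 2) k,
      a * a ≠ -(MvPolynomial.X 0 * MvPolynomial.X 1 ^ 3 + MvPolynomial.X 0 ^ 3) :=
    mul_self_ne_neg_of_aeval ![-Polynomial.X, 0] 1 (by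
      simp only [map_add, map_mul, map_pow, MvPolynomial.aeval_X, Matrix.cons_val_zero,
        Matrix.cons_val_one]
      ring)
  obtain ⟨hpf, hdf⟩ := prime_and_not_dvd_of_ringEquiv e f _ hef hcf
  obtain ⟨hpgx, hdgx⟩ := prime_and_not_dvd_of_ringEquiv e gx _ hegx hcgx
  obtain ⟨hpgy, hdgy⟩ := prime_and_not_dvd_of_ringEquiv e gy _ hegy hcgy
  have hX0 : (MvPolynomial.X 0 : MvPolynomial (Fin 2) k) ≠ 0 := MvPolynomial.X_ne_zero 0
  have hX1 : (MvPolynomial.X 1 : MvPolynomial (Fin 2) k) ≠ 0 := MvPolynomial.X_ne_zero 1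
  refine ⟨⟨(Ideal.span_singleton_prime hpf.ne_zero).mpr hpf, hpf.ne_zero,
      fun h => hdf _ _ hX1 he0 (Ideal.mem_span_singleton.mp h)⟩,
    ⟨(Ideal.span_singleton_prime hpgx.ne_zero).mpr hpgx,
      fun h => hdgx _ _ hX1 he0 (Ideal.mem_span_singleton.mp h), ?_⟩,
    ⟨(Ideal.span_singleton_prime hpgy.ne_zero).mpr hpgy,
      fun h => hdgy _ _ hX0 he1 (Ideal.mem_span_singleton.mp h), ?_⟩⟩
  · subst hf hgx
    simp only [map_add, map_pow, MvPolynomial.aeval_X, Fin.isValue, Fin.reduceEq, ↓reduceIte,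
      one_ne_zero]
    ring
  · subst hf hgy
    simp only [map_add, map_pow, MvPolynomial.aeval_X, Fin.isValue, Fin.reduceEq, ↓reduceIte,
      zero_ne_one]
    ring

end Summit.ResolutionOfSingularities.ResolutionOfSingularities.Theorems.FInjectiveMacaulayfication.E8Forms
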